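import Literature.NumberTheory.Automorphic.CentralDerivativesTranslationGL
import HarnessLib

/-!
# Uniform bounds for iterated Lie derivatives along arbitrary directions of bounded norm

Topic `NumberTheory/Automorphic`; namespace `Literature.NumberTheory.Automorphic`. Generic calculus
for the archimedean variable (`ArchimedeanCalculus`: `H : RealMatrixGroup A N` with `H.lie = ⊤`,
`H.carrier = ⊤`, i.e. the full linear group `GL(N, A)` with `A` finite-dimensional, `ι : H → G`,
the iterated Lie derivative `iterLieDeriv ι [Z₁, …, Z_m] φ = Z₁ (⋯ (Z_m φ))`). We PROVE:

* `exists_norm_iterLieDeriv_ofFn_le` — if `φ` is archimedean-smooth and **every** iterated Lie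
  derivative `(X₁ ⋯ X_m) φ` along a fixed word is bounded on `G`, then for each `m` there is ONE
  constant `C_m` with `‖(Z₁ ⋯ Z_m φ)(z)‖ ≤ C_m` for all `z ∈ G` and **all** directions
  `Z₁, …, Z_m ∈ 𝔤𝔩(N, A)` of norm `≤ 1` (for the `L^∞`-operator norm through which `IsArchSmooth` is
  defined);
* `norm_iterLieDeriv_ofFn_le_mul_prod` — the homogeneous form
  `‖(Z₁ ⋯ Z_m φ)(z)‖ ≤ C_m ∏ ‖Z_i‖` for arbitrary directions.

Proof: `Z ↦ (Z₁ ⋯ Z_m φ)(z)` is the multilinear map `iterLieDerivMatrixML` of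
`CentralDerivativesTranslationGL`; expand each `Z_i` in a real basis of the finite-dimensional space
`M_N(A)` (`Module.finBasis`, coordinates bounded by `‖equivFunL‖ · ‖Z_i‖`) and bound the finitely many
words in the basis vectors by hypothesis. This is the uniformity in the direction used when a
Whittaker function is estimated through `Ad(k⁻¹) X`, `k` in the maximal compact subgroup
(Moeglin–Waldspurger (1995), I.2.10–I.2.11: the constants depend only on the norms of the `X'`).
Everything here is proved; no definitions are introduced.

## References

* C. Moeglin, J.-L. Waldspurger, *Spectral decomposition and Eisenstein series* (1995), I.2.10,
  I.2.11 [MoeglinWaldspurger1995].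
* A. Borel, H. Jacquet, *Automorphic forms and automorphic representations*, Proc. Sympos. Pure
  Math. 33 (1979), part 1, §1.5 [BorelJacquet1979].
-/

noncomputable section

open Set Filter

namespace Literature.NumberTheory.Automorphic

variable {A : Type*} [NormedCommRing A] [NormedAlgebra ℝ A] [NormedAlgebra ℚ A] [CompleteSpace A]
  [StarRing A] {N : Type*} [Fintype N] [DecidableEq N] {H : RealMatrixGroup A N}
  {G : Type*} [Group G] (ι : H.carrier →* G)

-- the scoped `L∞`-operator normed structure on matrices, through which `IsArchSmooth` is defined
open scoped Matrix.Norms.Operator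

variable [FiniteDimensional ℝ A]

set_option backward.isDefEq.respectTransparency false in
/-- **Uniform bounds for iterated Lie derivatives along directions of bounded norm.** Let
`𝔤 = 𝔤𝔩(N, A)` (`H.lie = ⊤`, `H.carrier = ⊤`, `A` finite-dimensional), let `φ : G → ℂ` be
archimedean-smooth, and suppose that for every word `l` the function `iterLieDeriv ι l φ` is bounded on
`G`. Then for every `m` there is `C` with `‖(Z₁ ⋯ Z_m φ)(z)‖ ≤ C · ∏ᵢ ‖Zᵢ‖` for all `z` and all
`Z : Fin m → M_N(A)` (expand in a basis of `M_N(A)`; the map `Z ↦ (Z₁ ⋯ Z_m φ)(z)` is multilinear,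
`iterLieDerivMatrixML`). [cite: MoeglinWaldspurger1995, I.2.10] -/
theorem norm_iterLieDeriv_ofFn_le_mul_prod (hH : H.lie = ⊤) (hc : H.carrier = ⊤) {φ : G → ℂ}
    (hφ : IsArchSmooth ι φ) (hb : ∀ l : List H.lie, ∃ C : ℝ, ∀ z, ‖iterLieDeriv ι l φ z‖ ≤ C) (m : ℕ) :
    ∃ C : ℝ, 0 ≤ C ∧ ∀ (Z : Fin m → Matrix N N A) (z : G),
      ‖iterLieDeriv ι (List.ofFn fun i => RealMatrixGroup.lieOfTop hH (Z i)) φ z‖ ≤ C * ∏ i, ‖Z i‖ := by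
  classical
  -- a real basis of `M_N(A)` and the bound on its coordinate functionals
  set V := Matrix N N A with hV
  set d := Module.finrank ℝ V with hd
  set b : Module.Basis (Fin d) ℝ V := Module.finBasis ℝ V with hbdef
  set L : V ≃L[ℝ] (Fin d → ℝ) := b.equivFunL with hL
  set C₁ : ℝ := ‖(L : V →L[ℝ] (Fin d → ℝ))‖ with hC₁
  have hC₁0 : 0 ≤ C₁ := norm_nonneg _
  have hcoord : ∀ (v : V) (j : Fin d), ‖b.repr v j‖ ≤ C₁ * ‖v‖ := by
    intro v j
    have h1 : ‖b.repr v j‖ ≤ ‖(L v : Fin d → ℝ)‖ := by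
      have : (L v : Fin d → ℝ) j = b.repr v j := by
        rw [hL, Module.Basis.equivFunL_apply]
      rw [← this]
      exact norm_le_pi_norm (L v : Fin d → ℝ) j
    exact h1.trans ((L : V →L[ℝ] (Fin d → ℝ)).le_opNorm v)
  -- bounds for the finitely many words in the basis vectors
  choose Cw hCw using fun r : Fin m → Fin d =>
    hb (List.ofFn fun i => RealMatrixGroup.lieOfTop hH (b (r i)))
  refine ⟨∑ r : Fin m → Fin d, C₁ ^ m * |Cw r|, Finset.sum_nonneg fun r _ => by positivity, fun Z z => ?_⟩
  -- the multilinear expansion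
  set f := iterLieDerivMatrixML (ι := ι) hH hc ⟨φ, hφ⟩ z m with hf
  have key : iterLieDeriv ι (List.ofFn fun i => RealMatrixGroup.lieOfTop hH (Z i)) φ z =
      ∑ r : Fin m → Fin d, (∏ i, b.repr (Z i) (r i)) • f (fun i => b (r i)) := by
    have h0 : iterLieDeriv ι (List.ofFn fun i => RealMatrixGroup.lieOfTop hH (Z i)) φ z = f Z := by
      rw [hf, iterLieDerivMatrixML_apply]
    have hZ : Z = fun i => ∑ j, (b.repr (Z i) j) • b j := by
      funext i
      exact (b.sum_repr (Z i)).symm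
    rw [h0]
    conv_lhs => rw [hZ]
    rw [MultilinearMap.map_sum]
    refine Finset.sum_congr rfl fun r _ => ?_
    rw [MultilinearMap.map_smul_univ]
  have hfr : ∀ r : Fin m → Fin d, ‖f (fun i => b (r i))‖ ≤ |Cw r| := fun r => by
    rw [hf, iterLieDerivMatrixML_apply]
    exact (hCw r z).trans (le_abs_self _)
  rw [key]
  refine (norm_sum_le _ _).trans ?_
  rw [Finset.sum_mul]
  refine Finset.sum_le_sum fun r _ => ?_
  rw [norm_smul, norm_prod]
  calc (∏ i, ‖b.repr (Z i) (r i)‖) * ‖f fun i => b (r i)‖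
      ≤ (∏ i, C₁ * ‖Z i‖) * |Cw r| :=
        mul_le_mul (Finset.prod_le_prod (fun i _ => norm_nonneg _) fun i _ => hcoord (Z i) (r i))
          (hfr r) (norm_nonneg _) (Finset.prod_nonneg fun i _ => by positivity)
    _ = C₁ ^ m * |Cw r| * ∏ i, ‖Z i‖ := by
        rw [Finset.prod_mul_distrib, Finset.prod_const, Finset.card_univ, Fintype.card_fin]
        ring

set_option backward.isDefEq.respectTransparency false in
/-- **Uniform bound on directions of norm at most one**: under the same hypotheses, for every `m`
there is `C` with `‖(Z₁ ⋯ Z_m φ)(z)‖ ≤ C` whenever all `‖Zᵢ‖ ≤ 1`. [cite: MoeglinWaldspurger1995, I.2.10] -/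
theorem exists_norm_iterLieDeriv_ofFn_le (hH : H.lie = ⊤) (hc : H.carrier = ⊤) {φ : G → ℂ}
    (hφ : IsArchSmooth ι φ) (hb : ∀ l : List H.lie, ∃ C : ℝ, ∀ z, ‖iterLieDeriv ι l φ z‖ ≤ C) (m : ℕ) :
    ∃ C : ℝ, 0 ≤ C ∧ ∀ (Z : Fin m → Matrix N N A), (∀ i, ‖Z i‖ ≤ 1) → ∀ z : G,
      ‖iterLieDeriv ι (List.ofFn fun i => RealMatrixGroup.lieOfTop hH (Z i)) φ z‖ ≤ C := by
  obtain ⟨C, hC0, hC⟩ := norm_iterLieDeriv_ofFn_le_mul_prod ι hH hc hφ hb m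
  refine ⟨C, hC0, fun Z hZ z => (hC Z z).trans ?_⟩
  have hprod : ∏ i, ‖Z i‖ ≤ 1 := by
    calc ∏ i, ‖Z i‖ ≤ ∏ _i : Fin m, (1 : ℝ) :=
          Finset.prod_le_prod (fun i _ => norm_nonneg _) fun i _ => hZ i
      _ = 1 := by simp
  calc C * ∏ i, ‖Z i‖ ≤ C * 1 := mul_le_mul_of_nonneg_left hprod hC0
    _ = C := mul_one C

/-- **Homogeneity of constant words**: `((c Z)^m φ)(z) = c^m (Z^m φ)(z)` for a real scalar `c`
(multilinearity of `iterLieDerivMatrixML`). [folklore] -/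
theorem iterLieDeriv_replicate_smul (hH : H.lie = ⊤) (hc : H.carrier = ⊤) {φ : G → ℂ}
    (hφ : IsArchSmooth ι φ) (c : ℝ) (Z : Matrix N N A) (m : ℕ) (z : G) :
    iterLieDeriv ι (List.replicate m (RealMatrixGroup.lieOfTop hH (c • Z))) φ z =
      (c ^ m : ℝ) • iterLieDeriv ι (List.replicate m (RealMatrixGroup.lieOfTop hH Z)) φ z := by
  have h1 : List.replicate m (RealMatrixGroup.lieOfTop hH (c • Z)) =
      List.ofFn fun i : Fin m => RealMatrixGroup.lieOfTop hH ((fun i : Fin m => c • Z) i) := by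
    rw [List.ofFn_const]
  have h2 : List.replicate m (RealMatrixGroup.lieOfTop hH Z) =
      List.ofFn fun i : Fin m => RealMatrixGroup.lieOfTop hH ((fun _ : Fin m => Z) i) := by
    rw [List.ofFn_const]
  rw [h1, h2, ← iterLieDerivMatrixML_apply (ι := ι) hH hc ⟨φ, hφ⟩ z m,
    ← iterLieDerivMatrixML_apply (ι := ι) hH hc ⟨φ, hφ⟩ z m]
  have h3 : (fun _ : Fin m => c • Z) = fun i : Fin m => (fun _ : Fin m => c) i • (fun _ : Fin m => Z) i := rfl
  rw [h3, MultilinearMap.map_smul_univ, Finset.prod_const, Finset.card_univ, Fintype.card_fin]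

end Literature.NumberTheory.Automorphic
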